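import Std.Sat.CNF
import Summits.Ventures.DiscreteObjects.UnitDistance.KernelRupCheck
import HarnessLib

/-!
# Kernel-tier replay of RUP refutations for `Std.Sat.CNF Nat` (bridge to the tree's kernel RUP checker)

Cell `qec`, PARTITION v2 row type-11 (LRAT hook, KERNEL tier).  Lean core's verified LRAT checker
(`Std.Tactic.BVDecide.LRAT.check`) is evaluated by `native_decide` (tier CHECKED-native, axiom
`Lean.ofReduceBool`) but is not kernel-reducible (`decide +kernel` is stuck already on a two-clause
formula).  For the KERNEL tier (= CERTIFIED) we reuse the tree's kernel-evaluable RUP replayer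
`Summit.Ventures.DiscreteObjects.UnitDistance.KRup` (binary-trie clause store, bit-set assumptions,
structural recursion; soundness `KRup.checkAll_refutes`): this file converts a `CNF Nat` to its literal
convention (`2·x` = variable `x` true, `2·x+1` = false; clause ids `1, 2, …` in array order = the LRAT /
DIMACS ids) and proves `unsat_of_kernelRupCheck : kernelRupCheck f d cnf steps = true → cnf.Unsat`.
`steps` is the RUP proof as `(derived clause, hint ids)` in KRup's convention: derived clauses get the
CONSECUTIVE ids `m+1, m+2, …` (`m` = number of original clauses) — an LRAT proof (arbitrary increasing
ids, deletions) is brought to this form by renumbering ids by rank and dropping deletions, which does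
not affect validity of RUP hints.  RAT steps are not supported (the qec kernel-B leaves have none).
-/

namespace Summit.Ventures.QEC.Census.KernelReplay

open Std.Sat Summit.Ventures.DiscreteObjects.UnitDistance

/-- `Std.Sat` literal `(x, b)` ↦ KRup literal `2x` (`b = true`) / `2x+1` (`b = false`). -/
def litToKRup (l : Literal Nat) : ℕ := 2 * l.1 + (if l.2 then 0 else 1)

/-- Clause conversion (literal-wise, order kept). -/
def clauseToKRup (c : CNF.Clause Nat) : List ℕ := c.map litToKRup

/-- Formula conversion: the clause list in array order (clause `i` of the array gets KRup/LRAT id `i+1`). -/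
def cnfToKRup (f : CNF Nat) : List (List ℕ) := f.clauses.toList.map clauseToKRup

/-- The conversion respects truth of literals. -/
theorem litTrue_litToKRup (σ : ℕ → Bool) (l : Literal Nat) :
    KRup.litTrue σ (litToKRup l) = (σ l.1 == l.2) := by
  rcases l with ⟨x, b⟩
  unfold KRup.litTrue litToKRup
  cases b
  · simp only [Bool.false_eq_true, ↓reduceIte]
    have h1 : (2 * x + 1) / 2 = x := by omega
    have h2 : (2 * x + 1) % 2 = 1 := by omega
    rw [h1, h2]; cases σ x <;> rfl
  · simp only [↓reduceIte, Nat.add_zero]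
    have h1 : (2 * x) / 2 = x := by omega
    have h2 : (2 * x) % 2 = 0 := by omega
    rw [h1, h2]; cases σ x <;> rfl

/-- The conversion respects truth of clauses. -/
theorem clauseTrue_clauseToKRup (σ : ℕ → Bool) (c : CNF.Clause Nat) :
    KRup.clauseTrue σ (clauseToKRup c) = CNF.Clause.eval σ c := by
  induction c with
  | nil => rfl
  | cons l c ih =>
    have : KRup.clauseTrue σ (clauseToKRup (l :: c)) =
        (KRup.litTrue σ (litToKRup l) || KRup.clauseTrue σ (clauseToKRup c)) := by
      simp [KRup.clauseTrue, clauseToKRup]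
    rw [this, ih, litTrue_litToKRup, CNF.Clause.eval_cons]

/-- KERNEL REPLAY VERDICT: the RUP steps check against the store of the formula (ids `1 … m`, derived
clauses `m+1, …`; `f` = hint fuel > longest hint list, `d` = trie depth ≥ bit-length of the largest id)
AND some derived clause is empty. -/
def kernelRupCheck (f d : ℕ) (cnf : CNF Nat) (steps : List (List ℕ × List ℕ)) : Bool :=
  KRup.checkAll f d (KRup.Store.ofList d (cnfToKRup cnf)) (cnf.clauses.size + 1) steps &&
    (steps.map Prod.fst).contains []

/-- **Soundness of the kernel replay**: an accepted RUP refutation makes the formula unsatisfiable.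
(From `KRup.checkAll_refutes`: under any assignment satisfying every original clause, every checked
clause is true — impossible for the empty clause.) -/
theorem unsat_of_kernelRupCheck {f d : ℕ} {cnf : CNF Nat} {steps : List (List ℕ × List ℕ)}
    (h : kernelRupCheck f d cnf steps = true) : cnf.Unsat := by
  unfold kernelRupCheck at h
  rw [Bool.and_eq_true] at h
  obtain ⟨hrun, hnil⟩ := h
  have hnil' : [] ∈ steps.map Prod.fst := by simpa using hnil
  intro σ
  by_contra hsat
  rw [Bool.not_eq_false] at hsat
  have hall : (KRup.Store.ofList d (cnfToKRup cnf)).All fun C => KRup.clauseTrue σ C = true := by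
    apply KRup.Store.All.ofList
    intro C hC
    simp only [cnfToKRup, List.mem_map, Array.mem_toList_iff] at hC
    obtain ⟨c, hc, rfl⟩ := hC
    rw [clauseTrue_clauseToKRup]
    simp only [CNF.eval, Array.all_eq_true'] at hsat
    exact hsat c hc
  exact KRup.checkAll_refutes hall hrun hnil'

end Summit.Ventures.QEC.Census.KernelReplay
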